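import Summits.AtomisticToContinuum.Crystallization.Theorems.FrustratedLawDichotomyStrainedPatchHomEntryDomBest
import Summits.AtomisticToContinuum.Crystallization.Theorems.FrustratedLawDichotomyStrainedPatchHomEntryFitHcpSharp

/-!
# The SIX-COORDINATE (upper-triangle) search driver for `(H)`: verdicts read through the symmetrised box, lower-triangle entries never bisected

decomp-a2c hand-2 g23 (crux `AperiodicFrustratedLawGap`, stmt-AtomisticToContinuum-27623; census item (d) of hand-2 g22's repair census, the
«E-SYM 6-coordinate driver»).

The certificate `U` is SELF-ADJOINT (`hsa` is a hypothesis of every leaf-soundness statement of the entry framework), so `u_ba = u_ab`: the three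
lower-triangle entry coordinates of the 9-dimensional entry cube carry no information.  The drivers of record (`rr9` / `rr12`) nevertheless bisect all
nine entry coordinates and rely on the vacuous prune `asymOK` off the symmetric subspace — every symmetric cell of half-width `w` is visited by the
`≈ 2–3` boxes per symmetric pair that touch the subspace `u_ab = u_ba` (closed boxes sharing an endpoint are not pruned), i.e. `≈ 8–27×` more accepted
leaves than a search over the six free coordinates, on the fcc AND on the hcp side.

THE DRIVER.  `symU c (a,b) := c (min, max)` reads a lower-triangle datum from its mirror; a verdict `v` is run as `v (symU c) (symU w)`; the selectors
`rr6` / `rr9H` only ever bisect the six upper-triangle entries (and the three shuffle coordinates).  SOUNDNESS is one line: if the nine entries of a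
self-adjoint `U` lie in the box `(c, w)` then they lie in the symmetrised box `(symU c, symU w)` (`hbox_symU`, by `…HomEntryTable.entries_symm`), so
`v ∘ symU` is sound in exactly the `hver` sense of the generic tree/search theorems whenever `v` is — NO new tree theorem, the lower-triangle widths simply
stay at their root value and are never read.

* §1 `symU`, `hbox_symU`, the symmetrised verdicts of record `entryLeafOKDBs μ` (fcc: fundamental domain × best fit, `…HomEntryDomBest`) and
  `entryLeafOKH3s μ` (hcp: sharp fit, `…HomEntryFitHcpSharp`) with their soundness, selectors `order6`/`rr6`, `order9H`/`rr9H`;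
* §2 ★★ `fccHalf_of_entrySearchSym`, `hcpHalf_of_entrySearchSym`, ★★★ `homFloor_of_symSearches` (all `m`, `μ`) and the closing form of record
  `homFloor_625_of_symSearches : searchOK (entryLeafOKDBs muRec) rr6 F 0 rootC rootW = true → searchOK (entryLeafOKH3s muRec) rr9H F' 0 rootCH rootWH = true
  → HomFloor (1/625)` (any selectors in the generic form);
* §3 kernel smoke test (the symmetrised verdict reads a lower-triangle box datum from its mirror).

⇒ census instruments of record: `searchLeaves (entryLeafOKDBs muRec) rr6 F 0 rootC rootW` (fcc: 1/24 of the cube, sharpest fit prunes, 6 coordinates)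
and `searchLeaves (entryLeafOKH3s muRec) rr9H F 0 rootCH rootWH` (hcp: sharp fit, 9 coordinates).
Definitions computable; 0 sorry; standard axioms; no instances / notation / `#eval`.  `--supports stmt-AtomisticToContinuum-27623`.
-/

namespace Summit.AtomisticToContinuum.Crystallization.Theorems.FrustratedLawDichotomyStrainedPatchHomEntrySymBox

open scoped BigOperators RealInnerProductSpace
open Literature.Analysis.ValidatedNumerics.Numerics
open Summit.AtomisticToContinuum.Crystallization.Theorems.ChargedEnergyGapNegative (E3)
open Summit.AtomisticToContinuum.Crystallization.Theorems.FrustratedLawDichotomySchurCut (effPot w₄₅ ω₄)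
open Summit.AtomisticToContinuum.Crystallization.Theorems.FrustratedLawDichotomyAveragingRuleTightFree (TightNearCap BadNearCap)
open Summit.AtomisticToContinuum.Crystallization.Theorems.FrustratedLawDichotomyExemptAbsorption (ExemptNear)
open Summit.AtomisticToContinuum.Crystallization.Theorems.FrustratedLawDichotomyStrainedPatchHomSplit
open Summit.AtomisticToContinuum.Crystallization.Theorems.FrustratedLawDichotomyStrainedPatchHomPrunedPolar (homFloor_of_prunedBoxSums_selfAdjoint)
open Summit.AtomisticToContinuum.Crystallization.Theorems.FrustratedLawDichotomyStrainedPatchHomCertTree (CertTree treeOK)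
open Summit.AtomisticToContinuum.Crystallization.Theorems.FrustratedLawDichotomyStrainedPatchHomEntryGram
open Summit.AtomisticToContinuum.Crystallization.Theorems.FrustratedLawDichotomyStrainedPatchHomEntryGramHcp (rootCH rootWH)
open Summit.AtomisticToContinuum.Crystallization.Theorems.FrustratedLawDichotomyStrainedPatchHomEntryTable (muRec muRec_ok entries_symm)
open Summit.AtomisticToContinuum.Crystallization.Theorems.FrustratedLawDichotomyStrainedPatchHomEntrySearch
open Summit.AtomisticToContinuum.Crystallization.Theorems.FrustratedLawDichotomyStrainedPatchHomEntrySign (fccHalf_of_entryTreeDom)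
open Summit.AtomisticToContinuum.Crystallization.Theorems.FrustratedLawDichotomyStrainedPatchHomEntryDomBest (entryLeafOKDB entryLeafOKDB_sound)
open Summit.AtomisticToContinuum.Crystallization.Theorems.FrustratedLawDichotomyStrainedPatchHomEntryFitHcpSharp (entryLeafOKH3 entryLeafOKH3_sound)
open Literature.Barriers.AtomisticToContinuum.FlatleyTheil2015 (fccVec)

/-! ## §1. The symmetrised box, the verdicts, the selectors -/

/-- Read a lower-triangle datum from its mirror: `symU c (a, b) = c (a, b)` if `a ≤ b`, else `c (b, a)`. -/
def symU (c : Fin 3 × Fin 3 → ℤ) : Fin 3 × Fin 3 → ℤ := fun ab => if ab.1 ≤ ab.2 then c ab else c (ab.2, ab.1)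

/-- ★ **SOUNDNESS OF THE SYMMETRISATION**: the nine entries of a SELF-ADJOINT `U` in the box `(c, w)` lie in the box `(symU c, symU w)`. [folklore] -/
theorem hbox_symU {U : E3 →L[ℝ] E3} (hsa : ∀ v v' : E3, ⟪U v, v'⟫ = ⟪v, U v'⟫) {c w : Fin 3 × Fin 3 → ℤ}
    (hbox : ∀ ab : Fin 3 × Fin 3, |(U (EuclideanSpace.single ab.2 (1 : ℝ))) ab.1 - (c ab : ℝ) / SC| ≤ (w ab : ℝ) / SC) :
    ∀ ab : Fin 3 × Fin 3, |(U (EuclideanSpace.single ab.2 (1 : ℝ))) ab.1 - (symU c ab : ℝ) / SC| ≤ (symU w ab : ℝ) / SC := by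
  rintro ⟨a, b⟩
  by_cases h : a ≤ b
  · simp only [symU, h, ↓reduceIte]; exact hbox (a, b)
  · simp only [symU, h, ↓reduceIte]
    rw [entries_symm hsa a b]
    exact hbox (b, a)

/-- The same for the `U` block of an hcp entry/shuffle box (shuffle coordinates untouched). -/
def symH (c : (Fin 3 × Fin 3) ⊕ Fin 3 → ℤ) : (Fin 3 × Fin 3) ⊕ Fin 3 → ℤ :=
  fun k => match k with
    | Sum.inl ab => symU (fun ab' => c (Sum.inl ab')) ab
    | Sum.inr i => c (Sum.inr i)

/-- ★ **fcc VERDICT OF RECORD THROUGH THE SYMMETRISED BOX** (fundamental domain × best fit). -/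
def entryLeafOKDBs (μ : ℤ) (c w : Fin 3 × Fin 3 → ℤ) : Bool := entryLeafOKDB μ (symU c) (symU w)

/-- ★ Soundness of `entryLeafOKDBs` RELATIVE to the fundamental domain (the `hver` shape of `…HomEntrySign.fccHalf_of_entryTreeDom`). [folklore] -/
theorem entryLeafOKDBs_sound {μ : ℤ} {c w : Fin 3 × Fin 3 → ℤ} (h : entryLeafOKDBs μ c w = true) (U : E3 →L[ℝ] E3)
    (hsa : ∀ v v' : E3, ⟪U v, v'⟫ = ⟪v, U v'⟫) (hU : ‖U - 1‖ ≤ 1 / 4)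
    (hbox : ∀ ab : Fin 3 × Fin 3, |(U (EuclideanSpace.single ab.2 (1 : ℝ))) ab.1 - (c ab : ℝ) / SC| ≤ (w ab : ℝ) / SC)
    (h1 : (U (EuclideanSpace.single 1 (1 : ℝ))) 1 ≤ (U (EuclideanSpace.single 0 (1 : ℝ))) 0)
    (h2 : (U (EuclideanSpace.single 2 (1 : ℝ))) 2 ≤ (U (EuclideanSpace.single 1 (1 : ℝ))) 1)
    (h01 : 0 ≤ (U (EuclideanSpace.single 1 (1 : ℝ))) 0) (h02 : 0 ≤ (U (EuclideanSpace.single 2 (1 : ℝ))) 0) :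
    (∀ (M : ℕ) (z : Fin M → E3) (c : Fin M), Function.Injective z →
        Set.range z = {x : E3 | dist x (z c) ≤ 133 / 10 ∧ ∃ a : Fin 3 → ℤ, x = z c + latPt U fccVec a} →
        TightNearCap (9 / 5) (3 / 2) z c ∨ ExemptNear (9 / 5) ExRec z c ∨ BadNearCap (9 / 5) (3 / 2) z c) ∨
      (μ : ℝ) / SC ≤ ∑ b ∈ (Fintype.piFinset fun _ : Fin 3 => Finset.Icc (-7 : ℤ) 7).filter (fun b => b ≠ 0),
        effPot w₄₅ ω₄ (3 / 400) ‖latPt U fccVec b‖ :=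
  entryLeafOKDB_sound h U hsa hU (hbox_symU hsa hbox) h1 h2 h01 h02

/-- ★ **hcp VERDICT (sharp fit) THROUGH THE SYMMETRISED BOX.** -/
def entryLeafOKH3s (μ : ℤ) (c w : (Fin 3 × Fin 3) ⊕ Fin 3 → ℤ) : Bool := entryLeafOKH3 μ (symH c) (symH w)

/-- ★ Soundness of `entryLeafOKH3s` (the `hver` shape of `…HomEntrySearch.hcpHalf_of_entrySearch`). [folklore] -/
theorem entryLeafOKH3s_sound {μ : ℤ} {c w : (Fin 3 × Fin 3) ⊕ Fin 3 → ℤ} (h : entryLeafOKH3s μ c w = true) (U : E3 →L[ℝ] E3) (ξ : E3)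
    (hsa : ∀ v v' : E3, ⟪U v, v'⟫ = ⟪v, U v'⟫) (hU : ‖U - 1‖ ≤ 1 / 4)
    (hbox : ∀ ab : Fin 3 × Fin 3, |(U (EuclideanSpace.single ab.2 (1 : ℝ))) ab.1 - (c (Sum.inl ab) : ℝ) / SC| ≤ (w (Sum.inl ab) : ℝ) / SC)
    (hξ : ∀ i : Fin 3, |ξ i - (c (Sum.inr i) : ℝ) / SC| ≤ (w (Sum.inr i) : ℝ) / SC) :
    (∀ (M : ℕ) (z : Fin M → E3) (c : Fin M), Function.Injective z →
        Set.range z = {x : E3 | dist x (z c) ≤ 133 / 10 ∧ ∃ a : Fin 3 → ℤ,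
          x = z c + latPt U hexFrame a ∨ x = z c + latPt U hexFrame a + U (hcpShift + ξ)} →
        TightNearCap (9 / 5) (3 / 2) z c ∨ ExemptNear (9 / 5) ExRec z c ∨ BadNearCap (9 / 5) (3 / 2) z c) ∨
      (μ : ℝ) / SC ≤ ∑ b ∈ (Fintype.piFinset fun _ : Fin 3 => Finset.Icc (-7 : ℤ) 7).filter (fun b => b ≠ 0), effPot w₄₅ ω₄ (3 / 400) ‖latPt U hexFrame b‖ +
        ∑ b ∈ (Fintype.piFinset fun _ : Fin 3 => Finset.Icc (-7 : ℤ) 7), effPot w₄₅ ω₄ (3 / 400) ‖latPt U hexFrame b + U (hcpShift + ξ)‖ :=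
  entryLeafOKH3_sound h U ξ hsa hU (hbox_symU hsa hbox) hξ

/-- The six FREE fcc entry coordinates (diagonal first, then the upper triangle). -/
def order6 : List (Fin 3 × Fin 3) := [(0, 0), (1, 1), (2, 2), (0, 1), (0, 2), (1, 2)]

/-- ★ Selector for the six-coordinate fcc search: widest free coordinate (lower-triangle entries are never bisected). -/
def rr6 : ℕ → (Fin 3 × Fin 3 → ℤ) → (Fin 3 × Fin 3 → ℤ) → Fin 3 × Fin 3 := fun _ _ w => pick (0, 0) order6 w

/-- The nine FREE hcp coordinates: six entries + three shuffle coordinates. -/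
def order9H : List ((Fin 3 × Fin 3) ⊕ Fin 3) :=
  [Sum.inl (0, 0), Sum.inl (1, 1), Sum.inl (2, 2), Sum.inl (0, 1), Sum.inl (0, 2), Sum.inl (1, 2), Sum.inr 0, Sum.inr 1, Sum.inr 2]

/-- ★ Selector for the nine-coordinate hcp search. -/
def rr9H : ℕ → ((Fin 3 × Fin 3) ⊕ Fin 3 → ℤ) → ((Fin 3 × Fin 3) ⊕ Fin 3 → ℤ) → (Fin 3 × Fin 3) ⊕ Fin 3 :=
  fun _ _ w => pick (Sum.inl (0, 0)) order9H w

/-! ## §2. The halves and `(H)` from two symmetrised search Booleans -/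

/-- ★★ **THE fcc HALF FROM ONE SYMMETRISED SEARCH BOOLEAN** over the fundamental domain (`hfcc` of `…HomPrunedPolar.homFloor_of_prunedBoxSums_selfAdjoint`,
verbatim, for ALL self-adjoint positive `U` with `‖U − 1‖ ≤ 1/4`; any selector). [folklore] -/
theorem fccHalf_of_entrySearchSym {m : ℝ} {μ : ℤ} (hμ : 2 * (m + (-(7175 / 10000) + 3 / 400)) * SC ≤ μ)
    {sel : ℕ → (Fin 3 × Fin 3 → ℤ) → (Fin 3 × Fin 3 → ℤ) → Fin 3 × Fin 3} {fuel d : ℕ}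
    (h : searchOK (entryLeafOKDBs μ) sel fuel d rootC rootW = true) :
    ∀ U : E3 →L[ℝ] E3, (∀ v w : E3, inner ℝ (U v) w = inner ℝ v (U w)) → (∀ w : E3, 0 ≤ inner ℝ w (U w)) → ‖U - 1‖ ≤ 1 / 4 →
      (∀ (M : ℕ) (z : Fin M → E3) (c : Fin M), Function.Injective z →
          Set.range z = {x : E3 | dist x (z c) ≤ 133 / 10 ∧ ∃ a : Fin 3 → ℤ, x = z c + latPt U fccVec a} →
          TightNearCap (9 / 5) (3 / 2) z c ∨ ExemptNear (9 / 5) ExRec z c ∨ BadNearCap (9 / 5) (3 / 2) z c) ∨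
      m ≤ (∑ b ∈ (Fintype.piFinset fun _ : Fin 3 => Finset.Icc (-7 : ℤ) 7).filter (fun b => b ≠ 0),
        effPot w₄₅ ω₄ (3 / 400) ‖latPt U fccVec b‖) / 2 - (-(7175 / 10000) + 3 / 400) := by
  obtain ⟨t, ht⟩ := exists_tree_of_searchOK (entryLeafOKDBs μ) sel fuel d rootC rootW h
  exact fccHalf_of_entryTreeDom hμ (entryLeafOKDBs μ)
    (fun _ _ hv U hsa hU hbox h1 h2 h01 h02 => entryLeafOKDBs_sound hv U hsa hU hbox h1 h2 h01 h02) ht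

/-- ★★ **THE hcp HALF FROM ONE SYMMETRISED SEARCH BOOLEAN** (sharp fit; any selector). [folklore] -/
theorem hcpHalf_of_entrySearchSym {m : ℝ} {μ : ℤ} (hμ : 2 * (m + (-(7175 / 10000) + 3 / 400)) * SC ≤ μ)
    {sel : ℕ → ((Fin 3 × Fin 3) ⊕ Fin 3 → ℤ) → ((Fin 3 × Fin 3) ⊕ Fin 3 → ℤ) → (Fin 3 × Fin 3) ⊕ Fin 3} {fuel d : ℕ}
    (h : searchOK (entryLeafOKH3s μ) sel fuel d rootCH rootWH = true) :
    ∀ (U : E3 →L[ℝ] E3) (ξ : E3), (∀ v w : E3, inner ℝ (U v) w = inner ℝ v (U w)) → (∀ w : E3, 0 ≤ inner ℝ w (U w)) →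
      ‖U - 1‖ ≤ 1 / 4 → ‖ξ‖ ≤ 1 / 4 →
      (∀ (M : ℕ) (z : Fin M → E3) (c : Fin M), Function.Injective z →
          Set.range z = {x : E3 | dist x (z c) ≤ 133 / 10 ∧ ∃ a : Fin 3 → ℤ,
            x = z c + latPt U hexFrame a ∨ x = z c + latPt U hexFrame a + U (hcpShift + ξ)} →
          TightNearCap (9 / 5) (3 / 2) z c ∨ ExemptNear (9 / 5) ExRec z c ∨ BadNearCap (9 / 5) (3 / 2) z c) ∨
      m ≤ (∑ b ∈ (Fintype.piFinset fun _ : Fin 3 => Finset.Icc (-7 : ℤ) 7).filter (fun b => b ≠ 0),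
          effPot w₄₅ ω₄ (3 / 400) ‖latPt U hexFrame b‖ +
        ∑ b ∈ (Fintype.piFinset fun _ : Fin 3 => Finset.Icc (-7 : ℤ) 7),
          effPot w₄₅ ω₄ (3 / 400) ‖latPt U hexFrame b + U (hcpShift + ξ)‖) / 2 - (-(7175 / 10000) + 3 / 400) :=
  hcpHalf_of_entrySearch hμ (entryLeafOKH3s μ) (fun _ _ hv U ξ hsa hU hbox hξ => entryLeafOKH3s_sound hv U ξ hsa hU hbox hξ) h

/-- ★★★ **`(H) HomFloor m` FROM TWO SYMMETRISED SEARCH BOOLEANS** (fcc: fundamental domain × best fit, six free coordinates; hcp: sharp fit,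
nine free coordinates); every `m`, `μ` with `2 (m + e_W) SC ≤ μ`, any selectors. [folklore] -/
theorem homFloor_of_symSearches {m : ℝ} {μ : ℤ} (hμ : 2 * (m + (-(7175 / 10000) + 3 / 400)) * SC ≤ μ)
    {selF : ℕ → (Fin 3 × Fin 3 → ℤ) → (Fin 3 × Fin 3 → ℤ) → Fin 3 × Fin 3} {fuelF dF : ℕ}
    (hF : searchOK (entryLeafOKDBs μ) selF fuelF dF rootC rootW = true)
    {selH : ℕ → ((Fin 3 × Fin 3) ⊕ Fin 3 → ℤ) → ((Fin 3 × Fin 3) ⊕ Fin 3 → ℤ) → (Fin 3 × Fin 3) ⊕ Fin 3} {fuelH dH : ℕ}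
    (hH : searchOK (entryLeafOKH3s μ) selH fuelH dH rootCH rootWH = true) : HomFloor m :=
  homFloor_of_prunedBoxSums_selfAdjoint (fccHalf_of_entrySearchSym hμ hF) (hcpHalf_of_entrySearchSym hμ hH)

/-- ★★★ **`(H) HomFloor (1/625)` — THE CLOSING FORM OF RECORD**: `μ = muRec`, the six-coordinate fcc search with `rr6` and the nine-coordinate hcp
search with `rr9H` (census: `searchLeaves (entryLeafOKDBs muRec) rr6 F 0 rootC rootW ≠ 0` and `searchLeaves (entryLeafOKH3s muRec) rr9H F' 0 rootCH rootWH ≠ 0`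
give the two hypotheses by `…HomEntrySearch.searchOK_of_searchLeaves_ne_zero`). [folklore] -/
theorem homFloor_625_of_symSearches {fuelF fuelH : ℕ}
    (hF : searchOK (entryLeafOKDBs muRec) rr6 fuelF 0 rootC rootW = true)
    (hH : searchOK (entryLeafOKH3s muRec) rr9H fuelH 0 rootCH rootWH = true) : HomFloor (1 / 625) :=
  homFloor_of_symSearches muRec_ok hF hH

/-! ## §3. Kernel smoke test -/

/-- The symmetrised verdict reads the lower-triangle datum from its mirror: a box whose `(1,0)` datum is garbage (far outside the cube) but whose
`(0,1)` datum is sane is judged by its upper triangle — here the sign prune of the fundamental domain fires on `u₀₁ < 0`. -/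
example : symU (Function.update (Function.update rootC (0, 1) (-3000)) (1, 0) 99999999999999999) (1, 0) = -3000 ∧
    entryLeafOKDBs muRec (Function.update (Function.update rootC (0, 1) (-3000)) (1, 0) 99999999999999999) (fun _ => 1000) = true ∧
    rr6 0 rootC rootW = (0, 0) ∧ rr9H 0 rootCH rootWH = Sum.inl (0, 0) := by
  decide +kernel

end Summit.AtomisticToContinuum.Crystallization.Theorems.FrustratedLawDichotomyStrainedPatchHomEntrySymBox
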